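import Summits.Ventures.QEC.Census.TwoBlockQuotientMaps
import HarnessLib

/-!
# Quotient maps of bivariate-bicycle codes: `QC(A, B)` on `ℤ_ℓ × ℤ_m` pushed forward along
# `ℤ_ℓ × ℤ_m ↠ ℤ_ℓ' × ℤ_m'`, and the reduction maps `torusHom` with their index

The `BB.Code` phrasing of `Census/TwoBlockQuotientMaps.lean` (qec-search-8; tier KERNEL, all PROVED, axioms
standard, `[folklore]`, no priority word — see that file's header for the honest framing and the presearch):

* `pushforward φ C = QC(φ_* A, φ_* B)` (`pushforward_css`: its CSS code is the pushed-forward abelian two-block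
  code, via `coeffVec_push`);
* **`k_pushforward_le`**: `k(QC(φ_* A, φ_* B)) ≤ k(QC(A, B))` for every surjective `φ`;
* **`dZ_le_of_quotient_logical`** (a `Z`-logical `v` of the quotient code gives `d_Z(QC(A,B)) ≤ |ker φ|·|v|`,
  odd `|ker φ|`) and **`d_le_mul_d_pushforward`** (`d ≤ |ker φ| · d'`, odd index, `k' > 0`);
* the reduction maps `finMod L l : ℤ_L ↠ ℤ_l` (`l ∣ L`) and `torusHom L M l m : ℤ_L × ℤ_M ↠ ℤ_l × ℤ_m`,
  `torusHom_surjective`, **`fibreCard_torusHom = (L/l)·(M/m)`** (`card_filter_dvd`: `#{x ∈ ℤ_L : l ∣ x} = L/l`).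

Along `torusHom` a pure-power code `QC(A, B)` covers the code with every exponent reduced (`xᵃ ↦ x^{a mod l}`,
`yᵇ ↦ y^{b mod m}`, colliding monomials cancelling mod 2); worked instances (BB360 → BB72, BB90 → [[18,8,2]],
BB108 → a 36-qubit code) are filed in `Census/BB/BBQuotientCovers.lean`.
-/

namespace Summit.Ventures.QEC

open Matrix Literature.InformationTheory.QuantumCodes
open Literature.InformationTheory.QuantumCodes.AbelianTwoBlock

/-! ## Bivariate-bicycle phrasing: `QC(A, B)` on `ℤ_ℓ × ℤ_m` pushed forward along `ℤ_ℓ × ℤ_m ↠ ℤ_ℓ' × ℤ_m'` -/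

namespace BB

variable {ℓ m ℓ' m' : ℕ} [NeZero ℓ] [NeZero m] [NeZero ℓ'] [NeZero m']

/-- The quotient (pushed-forward) bivariate-bicycle code `QC(φ_* A, φ_* B)` on `ℤ_ℓ' × ℤ_m'` of
`C = QC(A, B)` on `ℤ_ℓ × ℤ_m` along an additive map `φ` (monomials `xᵃyᵇ ↦ φ (a, b)`, coefficients
mod 2). (definition) -/
def pushforward (φ : BB.Mono ℓ m →+ BB.Mono ℓ' m') (C : BB.Code ℓ m) : BB.Code ℓ' m' :=
  ⟨AbelianTwoBlock.push φ C.A, AbelianTwoBlock.push φ C.B⟩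

/-- `(pushforward φ C).A = φ_* C.A`. [folklore] -/
@[simp] theorem pushforward_A (φ : BB.Mono ℓ m →+ BB.Mono ℓ' m') (C : BB.Code ℓ m) :
    (pushforward φ C).A = AbelianTwoBlock.push φ C.A := rfl

/-- `(pushforward φ C).B = φ_* C.B`. [folklore] -/
@[simp] theorem pushforward_B (φ : BB.Mono ℓ m →+ BB.Mono ℓ' m') (C : BB.Code ℓ m) :
    (pushforward φ C).B = AbelianTwoBlock.push φ C.B := rfl

/-- Coefficient vectors (`g ↦ p(−g)`) commute with the push-forward. [folklore] -/
theorem coeffVec_push (φ : BB.Mono ℓ m →+ BB.Mono ℓ' m') (p : BB.Poly ℓ m) :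
    BB.coeffVec (AbelianTwoBlock.push φ p) = AbelianTwoBlock.push φ (BB.coeffVec p) := by
  funext g'
  simp only [BB.coeffVec_apply, AbelianTwoBlock.push]
  exact Fintype.sum_equiv (Equiv.neg _) _ _ fun g => by simp [map_neg, neg_eq_iff_eq_neg]

/-- The CSS code of the pushed-forward BB code is the pushed-forward abelian two-block code. [folklore] -/
theorem pushforward_css (φ : BB.Mono ℓ m →+ BB.Mono ℓ' m') (C : BB.Code ℓ m) :
    (pushforward φ C).css =
      css (AbelianTwoBlock.push φ (BB.coeffVec C.A)) (AbelianTwoBlock.push φ (BB.coeffVec C.B)) := by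
  show css (BB.coeffVec (AbelianTwoBlock.push φ C.A)) (BB.coeffVec (AbelianTwoBlock.push φ C.B)) = _
  rw [coeffVec_push, coeffVec_push]

/-- **`k(QC(φ_* A, φ_* B)) ≤ k(QC(A, B))`** for every surjection `φ : ℤ_ℓ × ℤ_m ↠ ℤ_ℓ' × ℤ_m'`: the number
of logical qubits can only grow when passing to a cover. [folklore] -/
theorem k_pushforward_le (φ : BB.Mono ℓ m →+ BB.Mono ℓ' m') (hφ : Function.Surjective φ) (C : BB.Code ℓ m) :
    (pushforward φ C).k ≤ C.k := by
  show (pushforward φ C).css.k ≤ C.css.k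
  rw [pushforward_css, BB.Code.css_eq C]
  exact AbelianTwoBlock.css_k_push_le φ hφ _ _

/-- **A `Z`-logical of the quotient BB code pulls back to a `Z`-logical of `QC(A, B)` of `|ker φ|` times
the weight** (odd `|ker φ|`), hence `d_Z(QC(A,B)) ≤ |ker φ| · |v|`. [folklore] -/
theorem dZ_le_of_quotient_logical (φ : BB.Mono ℓ m →+ BB.Mono ℓ' m') (hφ : Function.Surjective φ)
    (hodd : Odd (AbelianTwoBlock.fibreCard φ)) (C : BB.Code ℓ m) {v : BB.Mono ℓ' m' ⊕ BB.Mono ℓ' m' → ZMod 2}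
    (hv : (pushforward φ C).css.HX *ᵥ v = 0) (hv' : v ∉ (pushforward φ C).css.rowSpZ) :
    C.css.HX *ᵥ AbelianTwoBlock.pull φ v = 0 ∧ AbelianTwoBlock.pull φ v ∉ C.css.rowSpZ ∧
      C.css.dZ ≤ AbelianTwoBlock.fibreCard φ * hammingNorm v := by
  rw [pushforward_css] at hv hv'
  obtain ⟨h1, h2, h3⟩ := AbelianTwoBlock.pull_zLogical φ hφ hodd _ _ hv hv'
  rw [← BB.Code.css_eq C] at h1 h2
  exact ⟨h1, h2, h3 ▸ C.css.dZ_le_hammingNorm h1 h2⟩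

/-- **`d(QC(A, B)) ≤ |ker φ| · d(QC(φ_* A, φ_* B))`** along a surjection `φ` of ODD index whose quotient
code is non-trivial (`k' > 0`). (`d = d_Z = d_X` for BB codes, `BB.Code.d_eq_dZ`.) [folklore] -/
theorem d_le_mul_d_pushforward (φ : BB.Mono ℓ m →+ BB.Mono ℓ' m') (hφ : Function.Surjective φ)
    (hodd : Odd (AbelianTwoBlock.fibreCard φ)) (C : BB.Code ℓ m) (hk : 0 < (pushforward φ C).k) :
    C.d ≤ AbelianTwoBlock.fibreCard φ * (pushforward φ C).d := by
  have hk' : 0 < (css (AbelianTwoBlock.push φ (BB.coeffVec C.A))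
      (AbelianTwoBlock.push φ (BB.coeffVec C.B))).k := by
    rwa [show (pushforward φ C).k = (pushforward φ C).css.k from rfl, pushforward_css] at hk
  rw [BB.Code.d_eq_dZ, BB.Code.d_eq_dZ, pushforward_css, BB.Code.css_eq C]
  exact AbelianTwoBlock.css_dZ_le_mul_dZ_push φ hφ hodd _ _ hk'

/-! ### The reduction maps `ℤ_L × ℤ_M ↠ ℤ_l × ℤ_m` (`l ∣ L`, `m ∣ M`) -/

/-- Reduction `ℤ_L → ℤ_l`, `x ↦ x mod l`, an additive homomorphism when `l ∣ L`. (definition) -/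
def finMod (L l : ℕ) [NeZero L] [NeZero l] (hd : l ∣ L) : Fin L →+ Fin l where
  toFun x := Fin.ofNat l x.val
  map_zero' := by ext; simp
  map_add' x y := by
    ext
    simp only [Fin.val_add, Fin.val_ofNat]
    rw [Nat.mod_mod_of_dvd _ hd, Nat.add_mod]

/-- `finMod L l hd x = x mod l` on values. [folklore] -/
@[simp] theorem finMod_val (L l : ℕ) [NeZero L] [NeZero l] (hd : l ∣ L) (x : Fin L) :
    (finMod L l hd x).val = x.val % l := by
  simp [finMod]

/-- `finMod` is surjective (`y ↦ y` is a section). [folklore] -/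
theorem finMod_surjective (L l : ℕ) [NeZero L] [NeZero l] (hd : l ∣ L) :
    Function.Surjective (finMod L l hd) := fun y =>
  ⟨Fin.castLE (Nat.le_of_dvd (Nat.pos_of_ne_zero (NeZero.ne L)) hd) y, by
    ext; simp [Nat.mod_eq_of_lt y.isLt]⟩

/-- `finMod x = 0 ↔ l ∣ x`. [folklore] -/
theorem finMod_eq_zero_iff (L l : ℕ) [NeZero L] [NeZero l] (hd : l ∣ L) (x : Fin L) :
    finMod L l hd x = 0 ↔ l ∣ x.val := by
  rw [Fin.ext_iff, finMod_val, Fin.val_zero, Nat.dvd_iff_mod_eq_zero]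

/-- `#{x ∈ ℤ_L : l ∣ x} = L / l`. [folklore] -/
theorem card_filter_dvd (L l : ℕ) [NeZero l] (hd : l ∣ L) :
    (Finset.univ.filter fun x : Fin L => l ∣ x.val).card = L / l := by
  obtain ⟨q, hq⟩ := hd
  have hl : 0 < l := Nat.pos_of_ne_zero (NeZero.ne l)
  have hlt : ∀ i : Fin q, l * i.val < L := fun i => hq ▸ (Nat.mul_lt_mul_left hl).2 i.isLt
  let f : Fin q → Fin L := fun i => ⟨l * i.val, hlt i⟩
  have hf : Function.Injective f := fun i j h =>
    Fin.ext (Nat.eq_of_mul_eq_mul_left hl (by simpa [f] using congrArg Fin.val h))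
  have himg : (Finset.univ.filter fun x : Fin L => l ∣ x.val) = Finset.univ.image f := by
    ext x
    simp only [Finset.mem_filter, Finset.mem_univ, true_and, Finset.mem_image, f]
    constructor
    · rintro ⟨c, hc⟩
      have hcq : c < q := by
        have hx := x.isLt
        rw [hc, hq] at hx
        exact (Nat.mul_lt_mul_left hl).1 hx
      exact ⟨⟨c, hcq⟩, Fin.ext (by simp [hc])⟩
    · rintro ⟨i, rfl⟩
      exact ⟨i.val, rfl⟩
  rw [himg, Finset.card_image_of_injective _ hf, Finset.card_univ, Fintype.card_fin, hq,
    Nat.mul_div_cancel_left q hl]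

/-- The reduction `ℤ_L × ℤ_M ↠ ℤ_l × ℤ_m`, `(a, b) ↦ (a mod l, b mod m)` for `l ∣ L`, `m ∣ M`: the map
along which `QC(A, B)` on the big torus covers `QC(A mod, B mod)` on the small one. (definition) -/
def torusHom (L M l m : ℕ) [NeZero L] [NeZero M] [NeZero l] [NeZero m] (hl : l ∣ L) (hm : m ∣ M) :
    BB.Mono L M →+ BB.Mono l m :=
  (finMod L l hl).prodMap (finMod M m hm)

/-- `torusHom` is surjective. [folklore] -/
theorem torusHom_surjective (L M l m : ℕ) [NeZero L] [NeZero M] [NeZero l] [NeZero m]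
    (hl : l ∣ L) (hm : m ∣ M) : Function.Surjective (torusHom L M l m hl hm) := by
  rintro ⟨y₁, y₂⟩
  obtain ⟨x₁, h₁⟩ := finMod_surjective L l hl y₁
  obtain ⟨x₂, h₂⟩ := finMod_surjective M m hm y₂
  exact ⟨(x₁, x₂), Prod.ext h₁ h₂⟩

/-- **The index of `torusHom` is `(L/l)·(M/m)`**: `fibreCard (torusHom L M l m) = (L / l) * (M / m)`. [folklore] -/
theorem fibreCard_torusHom (L M l m : ℕ) [NeZero L] [NeZero M] [NeZero l] [NeZero m]
    (hl : l ∣ L) (hm : m ∣ M) :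
    AbelianTwoBlock.fibreCard (torusHom L M l m hl hm) = (L / l) * (M / m) := by
  unfold AbelianTwoBlock.fibreCard
  have : (Finset.univ.filter fun g : BB.Mono L M => torusHom L M l m hl hm g = 0) =
      (Finset.univ.filter fun x : Fin L => l ∣ x.val) ×ˢ (Finset.univ.filter fun y : Fin M => m ∣ y.val) := by
    ext ⟨x, y⟩
    simp only [Finset.mem_filter, Finset.mem_univ, true_and, Finset.mem_product, torusHom,
      AddMonoidHom.prodMap, AddMonoidHom.prod_apply, AddMonoidHom.coe_comp, Function.comp_apply,
      AddMonoidHom.coe_fst, AddMonoidHom.coe_snd, Prod.mk_eq_zero, finMod_eq_zero_iff]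
  rw [this, Finset.card_product, card_filter_dvd L l hl, card_filter_dvd M m hm]

end BB

end Summit.Ventures.QEC
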